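import Summits.ValiantsHypothesis.ValiantsHypothesis.Theses.FeketeSOS
import Summits.ValiantsHypothesis.ValiantsHypothesis.Theorems.FeketeSOSCharPSparseSOSTwoCuspTrivial
import Summits.ValiantsHypothesis.ValiantsHypothesis.Theorems.FeketeSOSCharPSparseSOSTwoCuspTwoMonomialSquares

/-!
# Strategist scratch (crux stmt-ValiantsHypothesis-14989 `CharPSparseSOS`) — typed statements quoted in
STRATEGY-CENSUS.md.  Nothing here is filed as an item; every `def` is a Prop that elaborates, so the census's
"as a signature" clauses are checkable.  No sorries, no theorems claimed.
-/

set_option linter.dupNamespace false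

namespace Summit.ValiantsHypothesis.ValiantsHypothesis.Cruxes.CharPSparseSOS.Strategist

open Polynomial Finset
open Summit.ValiantsHypothesis.ValiantsHypothesis.Theses.FeketeSOS

/-- (CORE) — the weakest additive statement every proof of the crux proves (p112874 + arithmetic):
weak-Sidon Paley sum-cliques are an additive POWER below the counting bound √p + 1. -/
def CoreSumClique : Prop :=
  ∃ δ : ℝ, 0 < δ ∧ ∃ p₀ : ℕ, ∀ (p : ℕ) [Fact p.Prime], p₀ ≤ p → ∀ Q : Finset (ZMod p),
    (∀ a ∈ Q, ∀ b ∈ Q, a ≠ b → legendreSym p (a + b).val = 1) →          -- Paley SUM-clique (restricted sums)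
    (∀ a ∈ Q, ∀ b ∈ Q, ∀ c ∈ Q, ∀ d ∈ Q, a ≠ b → c ≠ d → a + b = c + d →
        (a = c ∧ b = d) ∨ (a = d ∧ b = c)) →                                 -- weak Sidon
    (Q.card : ℝ) ≤ Real.sqrt p - (p : ℝ) ^ δ / 2 + 9

/-- (CORE₁) — the FIRST OPEN CASE of the wall, recommended as a stand-alone support/calibration item:
one notch below counting.  Counting gives C(|Q|,2) ≤ (p−1)/2; nothing better is in print. -/
def CoreSumCliqueOneNotch : Prop :=
  ∃ p₀ : ℕ, ∀ (p : ℕ) [Fact p.Prime], p₀ ≤ p → ∀ Q : Finset (ZMod p),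
    (∀ a ∈ Q, ∀ b ∈ Q, a ≠ b → legendreSym p (a + b).val = 1) →
    (∀ a ∈ Q, ∀ b ∈ Q, ∀ c ∈ Q, ∀ d ∈ Q, a ≠ b → c ≠ d → a + b = c + d →
        (a = c ∧ b = d) ∨ (a = d ∧ b = c)) →
    Q.card * (Q.card - 1) / 2 + Q.card ≤ (p - 1) / 2

/-- (★ord) — the ORDERED characteristic-p shadow: exact identity in K[X] (no folding), few squares.
`CharPSparseSOS → CharPSparseSOSOrdered` (fold exponents); the converse is NOT available (census §Transfer T1). -/
def CharPSparseSOSOrdered : Prop :=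
  ∃ δ : ℝ, 0 < δ ∧ ∃ p₀ : ℕ, ∀ (p : ℕ) [Fact p.Prime], p₀ ≤ p → ∀ (K : Type) [Field K] [CharP K p]
    (s : ℕ) (c : Fin s → K) (g : Fin s → Polynomial K), (s : ℝ) ≤ (p : ℝ) ^ δ →
    (∀ i, (g i).natDegree ≤ p ^ 2) →
    (∑ i, Polynomial.C (c i) * g i ^ 2) = ∑ m ∈ Finset.range p, Polynomial.C ((legendreSym p m : ℤ) : K) * Polynomial.X ^ m →
    (p : ℝ) ^ (1 / 2 + δ) ≤ ∑ i, ((g i).support.card : ℝ)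

/-- Erdős × Hilbert harmonic-mass lemma (ordered side; census §Transfer T1), typed over ℕ:
the pair sums ≥ L of a weak-Sidon set of naturals have harmonic mass ≤ (π/(2h))·(4h + |Q|)·(1 + 4h/L). -/
def SidonHarmonicMass : Prop :=
  ∀ (Q : Finset ℕ) (h L : ℕ), 1 ≤ h → 4 * h ≤ L →
    (∀ a ∈ Q, ∀ b ∈ Q, ∀ c ∈ Q, ∀ d ∈ Q, a ≠ b → c ≠ d → a + b = c + d →
        (a = c ∧ b = d) ∨ (a = d ∧ b = c)) →
    (∑ x ∈ (Q ×ˢ Q).filter (fun x => x.1 < x.2 ∧ L ≤ x.1 + x.2), (1 : ℝ) / ((x.1 : ℝ) + x.2))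
      ≤ Real.pi / (2 * h) * (4 * h + Q.card) * (1 + 4 * (h : ℝ) / L)

/-- Consequence on the ordered side (census §Transfer T1): a once-covering of [L, N) by restricted sumsets of
s' weak-Sidon sets of naturals forces s' ≫ log(N/L) — bounded fan-in Sidon-regime configurations are
impossible in K[X] / over ℂ, while cyclically (mod p) they are exactly the barrier (p = 13, 41 packings). -/
def OrderedBoundedFaninObstruction : Prop :=
  ∀ (s' : ℕ) (Qs : Fin s' → Finset ℕ) (L N h : ℕ), 1 ≤ h → 4 * h ≤ L → L < N →
    (∀ i, ∀ a ∈ Qs i, ∀ b ∈ Qs i, ∀ c ∈ Qs i, ∀ d ∈ Qs i, a ≠ b → c ≠ d → a + b = c + d →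
        (a = c ∧ b = d) ∨ (a = d ∧ b = c)) →
    (∀ i, (Qs i).card ≤ h) →
    (∀ n, L ≤ n → n < N → ∃ i, ∃ a ∈ Qs i, ∃ b ∈ Qs i, a < b ∧ a + b = n) →
    Real.log ((N : ℝ) / L) - 1 ≤ (s' : ℝ) * (Real.pi / (2 * h) * (5 * h) * 2)

/-- D1 of the census (REJECTED split, recorded as signatures): Sub_A = robust non-packing of QR by few
restricted sumsets (pure additive combinatorics; barrier-hard but genuine) … -/
def RobustNoPacking : Prop :=
  ∃ δ : ℝ, 0 < δ ∧ ∃ p₀ : ℕ, ∀ (p : ℕ) [Fact p.Prime], p₀ ≤ p → ∀ (s' : ℕ) (Qs : Fin s' → Finset (ZMod p)),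
    (s' : ℝ) ≤ (p : ℝ) ^ δ →
    (p : ℝ) ^ (1 / 2 + δ) ≤ 3 * ∑ i, ((Qs i).card : ℝ) +
      2 * (((Finset.univ : Finset (ZMod p)).filter (fun n =>
            (∑ i, (((Qs i) ×ˢ (Qs i)).filter (fun ab => ab.1.val < ab.2.val ∧ ab.1 + ab.2 = n)).card)
              ≠ (if n ≠ 0 ∧ legendreSym p n.val = 1 then 1 else 0))).card : ℝ)

/-- … and Sub_B = the "inverse theorem" (every cheap cyclic representation yields a cheap near-packing).
`RobustNoPacking → InversePacking → CharPSparseSOS` is two lines of real arithmetic, but Sub_B is the crux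
reworded: it is provable only vacuously (no conversion K-valued ↦ 0/1 exists), census §Decomposition D1. -/
def InversePacking : Prop :=
  ∃ A : ℕ, ∃ p₁ : ℕ, ∀ (p : ℕ) [Fact p.Prime], p₁ ≤ p → ∀ (K : Type) [Field K] [CharP K p]
    (s : ℕ) (c : Fin s → K) (g : Fin s → Polynomial K), (∀ i, (g i).natDegree < p) →
    ((Polynomial.X : Polynomial K) ^ p - 1 ∣ (∑ i, Polynomial.C (c i) * g i ^ 2) -
        ∑ m ∈ Finset.range p, Polynomial.C ((legendreSym p m : ℤ) : K) * Polynomial.X ^ m) →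
    ∃ (s' : ℕ) (Qs : Fin s' → Finset (ZMod p)), s' ≤ (s + 1) ^ A ∧
      3 * ∑ i, ((Qs i).card : ℝ) +
      2 * (((Finset.univ : Finset (ZMod p)).filter (fun n =>
            (∑ i, (((Qs i) ×ˢ (Qs i)).filter (fun ab => ab.1.val < ab.2.val ∧ ab.1 + ab.2 = n)).card)
              ≠ (if n ≠ 0 ∧ legendreSym p n.val = 1 then 1 else 0))).card : ℝ)
        ≤ ((s : ℝ) + 1) ^ A * ∑ i, ((g i).support.card : ℝ)

/-- Sanity: the crux trivially implies its ordered shadow's cyclic core when degrees are < p (fold is the identity);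
recorded only to pin the direction of the implication used in §Transfer. -/
theorem ordered_of_cyclic_lowdeg (K : Type) [Field K] (p : ℕ) [Fact p.Prime] (s : ℕ) (c : Fin s → K) (g : Fin s → Polynomial K)
    (h : (∑ i, Polynomial.C (c i) * g i ^ 2) =
      ∑ m ∈ Finset.range p, Polynomial.C ((legendreSym p m : ℤ) : K) * Polynomial.X ^ m) :
    (Polynomial.X : Polynomial K) ^ p - 1 ∣ (∑ i, Polynomial.C (c i) * g i ^ 2) -
        ∑ m ∈ Finset.range p, Polynomial.C ((legendreSym p m : ℤ) : K) * Polynomial.X ^ m := by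
  rw [h, sub_self]; exact dvd_zero _

end Summit.ValiantsHypothesis.ValiantsHypothesis.Cruxes.CharPSparseSOS.Strategist

/-! ## Route-level recommendation, certified: the ORDERED pair already yields the thesis X

`SublinearShadowOrdered` = item SublinearShadow with the conclusion kept EXACT in K[X] (no folding; this is what the
depth-0 reduction produces before the fold, and what any p-adic descent produces).  The glue below is the route's
`closes` arithmetic verbatim with the two ordered items in place of (CharPSparseSOS, SublinearShadow). -/

namespace Summit.ValiantsHypothesis.ValiantsHypothesis.Cruxes.CharPSparseSOS.Strategist

open Summit.ValiantsHypothesis.ValiantsHypothesis.Theses.FeketeSOS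

def SublinearShadowOrdered : Prop :=
  ∃ A p₁ : ℕ, ∀ (p : ℕ) [Fact p.Prime], p₁ ≤ p → ∀ (s : ℕ) (c : Fin s → ℂ) (g : Fin s → Polynomial ℂ),
    (∀ i, (g i).natDegree ≤ p ^ 2) → (∑ i, (g i).support.card) ^ 4 ≤ p ^ 3 →
    (∑ i, Polynomial.C (c i) * g i ^ 2) = ∑ m ∈ Finset.range p, Polynomial.C ((legendreSym p m : ℤ) : ℂ) * Polynomial.X ^ m →
    ∃ (K : Type) (_ : Field K) (_ : CharP K p) (d : ℕ) (c' : Fin d → K) (g' : Fin d → Polynomial K),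
      d ≤ (s + 1) ^ A ∧ (∀ j, (g' j).natDegree ≤ p ^ 2) ∧
      (∑ j, (g' j).support.card) ≤ (s + 1) ^ A * ∑ i, (g i).support.card ∧
      (∑ j, Polynomial.C (c' j) * g' j ^ 2) = ∑ m ∈ Finset.range p, Polynomial.C ((legendreSym p m : ℤ) : K) * Polynomial.X ^ m

/-- The thesis X from the ORDERED pair (same real-exponent bookkeeping as the route's `closes`). -/
theorem feketeSOSHard_of_ordered (h₂ : CharPSparseSOSOrdered) (h₃ : SublinearShadowOrdered) :
    FeketeSOSHard := by
  obtain ⟨δ', hδ', p₀', Hstar⟩ := h₂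
  obtain ⟨A, p₁, Hsh⟩ := h₃
  set M : ℝ := (A : ℝ) + 1 with hM
  have hM0 : (0 : ℝ) < M := by rw [hM]; have : (0:ℝ) ≤ A := Nat.cast_nonneg A; linarith
  set δ : ℝ := min (1 / 4) (δ' / (2 * M)) with hδdef
  have hδpos : 0 < δ := lt_min (by norm_num) (by positivity)
  have hδ4 : δ ≤ 1 / 4 := min_le_left _ _
  have hδM : δ * M ≤ δ' / 2 := by
    have h1 : δ ≤ δ' / (2 * M) := min_le_right _ _
    calc δ * M ≤ δ' / (2 * M) * M := mul_le_mul_of_nonneg_right h1 hM0.le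
      _ = δ' / 2 := by field_simp
  have hδA : δ * A ≤ δ' / 2 := by
    have : δ * (A : ℝ) ≤ δ * M := mul_le_mul_of_nonneg_left (by rw [hM]; linarith) hδpos.le
    exact this.trans hδM
  obtain ⟨N, hN⟩ : ∃ N : ℕ, ((2 : ℝ) ^ A) ^ (2 / δ') ≤ (N : ℝ) := ⟨_, Nat.le_ceil _⟩
  refine ⟨δ, hδpos, max p₀' (max p₁ (max N 2)), ?_⟩
  intro p _ hp s c g hs hdeg hrep
  have hprime : p.Prime := Fact.out
  have hp₀' : p₀' ≤ p := le_trans (le_max_left _ _) hp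
  have hp₁ : p₁ ≤ p := le_trans (le_trans (le_max_left _ _) (le_max_right _ _)) hp
  have hpN : N ≤ p := le_trans (le_trans (le_trans (le_max_left _ _) (le_max_right _ _)) (le_max_right _ _)) hp
  have hp1 : (1 : ℝ) ≤ (p : ℝ) := by exact_mod_cast hprime.one_lt.le
  have hp0 : (0 : ℝ) < (p : ℝ) := by linarith
  have h2A : (2 : ℝ) ^ A ≤ (p : ℝ) ^ (δ' / 2) := by
    have h2A0 : (0 : ℝ) ≤ (2 : ℝ) ^ A := by positivity
    have hbase : ((2 : ℝ) ^ A) ^ (2 / δ') ≤ (p : ℝ) := hN.trans (by exact_mod_cast hpN)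
    have hb0 : (0 : ℝ) ≤ ((2 : ℝ) ^ A) ^ (2 / δ') := Real.rpow_nonneg h2A0 _
    have hmono : (((2 : ℝ) ^ A) ^ (2 / δ')) ^ (δ' / 2) ≤ (p : ℝ) ^ (δ' / 2) :=
      Real.rpow_le_rpow hb0 hbase (by positivity)
    have hid : (((2 : ℝ) ^ A) ^ (2 / δ')) ^ (δ' / 2) = (2 : ℝ) ^ A := by
      rw [← Real.rpow_mul h2A0]
      have : (2 / δ') * (δ' / 2) = 1 := by field_simp
      rw [this, Real.rpow_one]
    rw [hid] at hmono
    exact hmono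
  by_contra hlt
  push Not at hlt
  set S : ℕ := ∑ i, (g i).support.card with hS
  have hcastS : (∑ i, ((g i).support.card : ℝ)) = (S : ℝ) := by rw [hS]; push_cast; rfl
  rw [hcastS] at hlt
  have h34 : (p : ℝ) ^ (1 / 2 + δ) ≤ (p : ℝ) ^ (3 / 4 : ℝ) :=
    Real.rpow_le_rpow_of_exponent_le hp1 (by linarith)
  have hSlt : (S : ℝ) < (p : ℝ) ^ (3 / 4 : ℝ) := lt_of_lt_of_le hlt h34
  have hS4 : S ^ 4 ≤ p ^ 3 := by
    have hS0 : (0 : ℝ) ≤ (S : ℝ) := Nat.cast_nonneg S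
    have h4 : (S : ℝ) ^ (4 : ℕ) < ((p : ℝ) ^ (3 / 4 : ℝ)) ^ (4 : ℕ) :=
      pow_lt_pow_left₀ hSlt hS0 (by norm_num)
    have e1 : ((p : ℝ) ^ (3 / 4 : ℝ)) ^ (4 : ℕ) = (p : ℝ) ^ (3 : ℕ) := by
      rw [← Real.rpow_natCast, ← Real.rpow_mul hp0.le]; norm_num
    rw [e1] at h4
    have : ((S ^ 4 : ℕ) : ℝ) < ((p ^ 3 : ℕ) : ℝ) := by push_cast; exact h4
    exact le_of_lt (by exact_mod_cast this)
  obtain ⟨K, instF, instC, d, c', g', hd, hdeg', hsupp', heq'⟩ := Hsh p hp₁ s c g hdeg hS4 hrep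
  have hpδ1 : (1 : ℝ) ≤ (p : ℝ) ^ δ := Real.one_le_rpow hp1 hδpos.le
  have hs1 : (s : ℝ) + 1 ≤ 2 * (p : ℝ) ^ δ := by linarith
  have hsA : ((s : ℝ) + 1) ^ A ≤ (2 : ℝ) ^ A * (p : ℝ) ^ (δ * A) := by
    have h := pow_le_pow_left₀ (by positivity) hs1 A
    have e : (2 * (p : ℝ) ^ δ) ^ A = (2 : ℝ) ^ A * (p : ℝ) ^ (δ * A) := by
      rw [mul_pow, ← Real.rpow_natCast ((p : ℝ) ^ δ) A, ← Real.rpow_mul hp0.le]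
    rw [e] at h; exact h
  have hbound : (2 : ℝ) ^ A * (p : ℝ) ^ (δ * A) ≤ (p : ℝ) ^ (δ' / 2) * (p : ℝ) ^ (δ * A) :=
    mul_le_mul_of_nonneg_right h2A (Real.rpow_nonneg hp0.le _)
  have hdR : (d : ℝ) ≤ (p : ℝ) ^ δ' := by
    have h1 : (d : ℝ) ≤ ((s : ℝ) + 1) ^ A := by
      have : ((d : ℕ) : ℝ) ≤ (((s + 1) ^ A : ℕ) : ℝ) := by exact_mod_cast hd
      push_cast at this; exact this
    have h2 : (p : ℝ) ^ (δ' / 2) * (p : ℝ) ^ (δ * A) ≤ (p : ℝ) ^ δ' := by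
      rw [← Real.rpow_add hp0]
      exact Real.rpow_le_rpow_of_exponent_le hp1 (by linarith)
    exact h1.trans (hsA.trans (hbound.trans h2))
  have hstarK := Hstar p hp₀' K d c' g' hdR hdeg' heq'
  have hsum' : (∑ j, ((g' j).support.card : ℝ)) ≤ ((s : ℝ) + 1) ^ A * (S : ℝ) := by
    have : ((∑ j, (g' j).support.card : ℕ) : ℝ) ≤ (((s + 1) ^ A * S : ℕ) : ℝ) := by exact_mod_cast hsupp'
    push_cast at this
    have e : (∑ j, ((g' j).support.card : ℝ)) = ((∑ j, (g' j).support.card : ℕ) : ℝ) := by push_cast; rfl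
    rw [e]; push_cast; exact this
  have hS0 : (0 : ℝ) ≤ (S : ℝ) := Nat.cast_nonneg S
  have hlt2 : ((s : ℝ) + 1) ^ A * (S : ℝ) <
      (p : ℝ) ^ (δ' / 2) * (p : ℝ) ^ (δ * A) * (p : ℝ) ^ (1 / 2 + δ) := by
    have hc : ((s : ℝ) + 1) ^ A ≤ (p : ℝ) ^ (δ' / 2) * (p : ℝ) ^ (δ * A) := hsA.trans hbound
    have hcpos : (0 : ℝ) < (p : ℝ) ^ (δ' / 2) * (p : ℝ) ^ (δ * A) := by positivity
    calc ((s : ℝ) + 1) ^ A * (S : ℝ) ≤ (p : ℝ) ^ (δ' / 2) * (p : ℝ) ^ (δ * A) * (S : ℝ) :=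
          mul_le_mul_of_nonneg_right hc hS0
      _ < (p : ℝ) ^ (δ' / 2) * (p : ℝ) ^ (δ * A) * (p : ℝ) ^ (1 / 2 + δ) :=
          mul_lt_mul_of_pos_left hlt hcpos
  have hexp : (p : ℝ) ^ (δ' / 2) * (p : ℝ) ^ (δ * A) * (p : ℝ) ^ (1 / 2 + δ) ≤ (p : ℝ) ^ (1 / 2 + δ') := by
    rw [← Real.rpow_add hp0, ← Real.rpow_add hp0]
    exact Real.rpow_le_rpow_of_exponent_le hp1 (by linarith)
  exact lt_irrefl _ (lt_of_le_of_lt hstarK (lt_of_le_of_lt hsum' (lt_of_lt_of_le hlt2 hexp)))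

/-- Direction check: the filed crux implies its ordered shadow (fold exponents) — so the ordered item is WEAKER. -/
theorem ordered_weaker_pointwise (K : Type) [Field K] (p : ℕ) [Fact p.Prime] [CharP K p]
    (s : ℕ) (c : Fin s → K) (g : Fin s → Polynomial K)
    (h : (∑ i, Polynomial.C (c i) * g i ^ 2) =
      ∑ m ∈ Finset.range p, Polynomial.C ((legendreSym p m : ℤ) : K) * Polynomial.X ^ m) :
    (Polynomial.X : Polynomial K) ^ p - 1 ∣ (∑ i, Polynomial.C (c i) * (g i %ₘ (Polynomial.X ^ p - 1)) ^ 2) -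
      ∑ m ∈ Finset.range p, Polynomial.C ((legendreSym p m : ℤ) : K) * Polynomial.X ^ m := by
  rw [← h]
  rw [← Finset.sum_sub_distrib]
  apply Finset.dvd_sum
  intro i _
  rw [← mul_sub]
  apply Dvd.dvd.mul_left
  have hq : (Polynomial.X ^ p - 1 : Polynomial K) ∣ (g i %ₘ (Polynomial.X ^ p - 1)) - g i := by
    have := Polynomial.modByMonic_add_div (g i) (Polynomial.X ^ p - 1 : Polynomial K)
    refine ⟨-(g i /ₘ (Polynomial.X ^ p - 1)), ?_⟩
    linear_combination this
  have : (g i %ₘ (Polynomial.X ^ p - 1)) ^ 2 - g i ^ 2 =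
      ((g i %ₘ (Polynomial.X ^ p - 1)) - g i) * ((g i %ₘ (Polynomial.X ^ p - 1)) + g i) := by ring
  rw [this]
  exact Dvd.dvd.mul_right hq _


/-- **The ordered shadow is WEAKER than the filed crux** (kernel-checked direction for census §Transfer T1 /
§Recommendation): fold each `g_i` modulo `X^p − 1` (degree `< p`, support does not grow — tree lemmas
`tcm_natDegree_fold_lt`, `card_support_fold_le`) and apply `CharPSparseSOS` to the folded representation. -/
theorem charPSparseSOSOrdered_of_charPSparseSOS (h : CharPSparseSOS) : CharPSparseSOSOrdered := by
  obtain ⟨δ, hδ, p₀, H⟩ := h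
  refine ⟨δ, hδ, p₀, ?_⟩
  intro p hpFact hp K _ _ s c g hs _hdeg heq
  have hprime : p.Prime := Fact.out
  -- folded representation
  set g' : Fin s → Polynomial K := fun i => g i %ₘ ((Polynomial.X : Polynomial K) ^ p - 1) with hg'
  have hdeg' : ∀ i, (g' i).natDegree < p := fun i =>
    Summit.ValiantsHypothesis.ValiantsHypothesis.Theorems.CharPSparseSOSTwoCusp.tcm_natDegree_fold_lt p (g i)
  have hdvd' : (Polynomial.X : Polynomial K) ^ p - 1 ∣ (∑ i, Polynomial.C (c i) * g' i ^ 2) -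
      ∑ m ∈ Finset.range p, Polynomial.C ((legendreSym p m : ℤ) : K) * Polynomial.X ^ m :=
    ordered_weaker_pointwise K p s c g heq
  have hmain := H p hp K s c g' hs hdeg' hdvd'
  refine hmain.trans ?_
  have hle : ∀ i, ((g' i).support.card : ℝ) ≤ ((g i).support.card : ℝ) := fun i => by
    exact_mod_cast Summit.ValiantsHypothesis.ValiantsHypothesis.Theorems.CharPSparseSOSTwoCusp.card_support_fold_le
      p hprime.pos (g i)
  exact Finset.sum_le_sum fun i _ => hle i

end Summit.ValiantsHypothesis.ValiantsHypothesis.Cruxes.CharPSparseSOS.Strategist
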